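import Literature.Computability.QuantumAlgorithms.CliffordTwistedConvolution
import Mathlib.Algebra.Order.BigOperators.Ring.Finset

/-!
# Envelopes and acceptance accounting for classical rejection sampling of the Clifford product (A-118 / OPEN-32)

HONEST FRAMING: instance-level adjudication of specific advantage claims; no claim about
BQP vs BPP or the summit.

Context (cell pub-qadeq, claim A-118 = K. A. Muchane, *Quantum algorithm for Clifford
multiplication*, arXiv:2607.10473v1; CLAIMS §1 OPEN-32, adjudication `pub-qadeq-deq-1/DEQ-A118.md`
in preparation by unit pub-qadeq-deq-1; this module filed by the cell lead as LEAN support).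
Row A-118 (b) types the classical comparator under sample-and-query access to the two coefficient
vectors: the output distribution `|c_z|²/‖c‖²` of the post-selected quantum branch is sampled
classically by REJECTION, with acceptance probability equal to the quantum branch's own success
probability `p₀ = 2^{-n} Σ_z |c_z|²` (`CliffordTwistedConvolution.circuitState_zero_norm_sq`).
This file proves the two Cauchy–Schwarz envelopes that make the two natural proposals valid and
the exact acceptance accounting:

* `norm_sq_twConv_le` — uniform proposal: `|c_z|² ≤ ‖a‖² ‖b‖²` for every `z`
  (so the ratio `|c_z|²/(‖a‖²‖b‖²)` is a valid acceptance probability);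
* `norm_sq_twConv_le_card_mul` — product proposal `z = x ⊕ y`, `x ∼ |a_x|²/‖a‖²`,
  `y ∼ |b_y|²/‖b‖²` (proposal mass `π(z) ∝ Σ_x |a_x|²|b_{x⊕z}|²`): `|c_z|² ≤ N Σ_x |a_x|² |b_{x⊕z}|²`;
* `sum_norm_sq_twConv_le`, `successProbability_le_one` — consequently `Σ_z |c_z|² ≤ N‖a‖²‖b‖²`,
  i.e. `p₀ ≤ 1` for normalised inputs (consistency with `successProbability`);
* `sum_prodProposal` — the product proposal is normalised: `Σ_z Σ_x |a_x|²|b_{x⊕z}|² = ‖a‖²‖b‖²`;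
* `uniformProposal_acceptance`, `prodProposal_acceptance` — for normalised inputs BOTH samplers
  accept with probability exactly `p₀ = 2^{-n} Σ_z |c_z|²`, the success probability of the
  un-amplified quantum branch (Muchane Thm. 2.5), so the expected number of classical trials equals
  the expected number of quantum repetitions, `1/p₀`.

Weights: the `±1` signature weights `sigWeight ℂ p` of `Cℓ_{p,q}` (so `|χ| = 1`). Elementary
(`norm_sum_le`, `Finset.sum_mul_sq_le_sq_mul_sq`, reindexing over `(ℤ/2)ⁿ`); no definition, no named
fact, no `sorry`. The cost of EVALUATING `c_z` (exactly `O(N)` per `z`, or by inner-product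
estimation under SQ access) is not the subject of this file.
-/

noncomputable section

namespace Summit.QuantumAdvantage.Dequantization.CliffordProductEnvelope

open Finset Literature.Computability.QuantumAlgorithms.CliffordTwistedConvolution

variable {n : ℕ}

/-- Triangle inequality with unimodular cocycle: `|c_z| ≤ Σ_x |a_x| |b_{x⊕z}|`. -/
theorem norm_twConv_le_sum (p : ℕ) (a b : MV n ℂ) (z : Blade n) :
    ‖twConv (sigWeight ℂ p) a b z‖ ≤ ∑ x : Blade n, ‖a x‖ * ‖b (x + z)‖ := by
  unfold twConv
  refine (norm_sum_le _ _).trans (le_of_eq ?_)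
  refine Finset.sum_congr rfl fun x _ => ?_
  rw [norm_mul, norm_mul, ← chi, norm_chi, mul_one]

/-- Reindexing over `(ℤ/2)ⁿ`: `Σ_x g(x ⊕ z) = Σ_y g(y)`. -/
theorem sum_comp_add_right (g : Blade n → ℝ) (z : Blade n) :
    ∑ x : Blade n, g (x + z) = ∑ y : Blade n, g y :=
  Fintype.sum_equiv (Equiv.addRight z) _ _ fun x => by simp

/-- Reindexing over `(ℤ/2)ⁿ`: `Σ_z g(x ⊕ z) = Σ_y g(y)`. -/
theorem sum_comp_add_left (g : Blade n → ℝ) (x : Blade n) :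
    ∑ z : Blade n, g (x + z) = ∑ y : Blade n, g y :=
  Fintype.sum_equiv (Equiv.addLeft x) _ _ fun z => by simp

/-- **Uniform-proposal envelope (Cauchy–Schwarz).** Every output coefficient of the Clifford product
satisfies `|c_z|² ≤ (Σ_x |a_x|²)(Σ_y |b_y|²)`; hence `|c_z|²/(‖a‖²‖b‖²) ≤ 1` is a valid acceptance
ratio for rejection from the uniform proposal on the `N = 2ⁿ` blades. -/
theorem norm_sq_twConv_le (p : ℕ) (a b : MV n ℂ) (z : Blade n) :
    ‖twConv (sigWeight ℂ p) a b z‖ ^ 2 ≤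
      (∑ x : Blade n, ‖a x‖ ^ 2) * (∑ y : Blade n, ‖b y‖ ^ 2) := by
  have h1 := norm_twConv_le_sum p a b z
  have h2 := Finset.sum_mul_sq_le_sq_mul_sq (univ : Finset (Blade n))
    (fun x => ‖a x‖) (fun x => ‖b (x + z)‖)
  have h3 : ∑ x : Blade n, ‖b (x + z)‖ ^ 2 = ∑ y : Blade n, ‖b y‖ ^ 2 :=
    sum_comp_add_right (fun y => ‖b y‖ ^ 2) z
  calc ‖twConv (sigWeight ℂ p) a b z‖ ^ 2
        ≤ (∑ x : Blade n, ‖a x‖ * ‖b (x + z)‖) ^ 2 := pow_le_pow_left₀ (norm_nonneg _) h1 2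
    _ ≤ (∑ x : Blade n, ‖a x‖ ^ 2) * ∑ x : Blade n, ‖b (x + z)‖ ^ 2 := h2
    _ = _ := by rw [h3]

/-- **Product-proposal envelope (Cauchy–Schwarz with the all-ones vector).** `|c_z|² ≤
N · Σ_x |a_x|² |b_{x⊕z}|²` with `N = 2ⁿ`; hence `|c_z|²/(N Σ_x |a_x|²|b_{x⊕z}|²) ≤ 1` is a valid
acceptance ratio for rejection from the proposal `z = x ⊕ y`, `x ∼ |a_x|²`, `y ∼ |b_y|²`. -/
theorem norm_sq_twConv_le_card_mul (p : ℕ) (a b : MV n ℂ) (z : Blade n) :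
    ‖twConv (sigWeight ℂ p) a b z‖ ^ 2 ≤
      (2 : ℝ) ^ n * ∑ x : Blade n, ‖a x‖ ^ 2 * ‖b (x + z)‖ ^ 2 := by
  have h1 := norm_twConv_le_sum p a b z
  have h2 := Finset.sum_mul_sq_le_sq_mul_sq (univ : Finset (Blade n))
    (fun _ => (1 : ℝ)) (fun x => ‖a x‖ * ‖b (x + z)‖)
  have hcard : ∑ _x : Blade n, (1 : ℝ) ^ 2 = (2 : ℝ) ^ n := by
    simp
  calc ‖twConv (sigWeight ℂ p) a b z‖ ^ 2
        ≤ (∑ x : Blade n, ‖a x‖ * ‖b (x + z)‖) ^ 2 := pow_le_pow_left₀ (norm_nonneg _) h1 2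
    _ = (∑ x : Blade n, 1 * (‖a x‖ * ‖b (x + z)‖)) ^ 2 := by simp
    _ ≤ (∑ _x : Blade n, (1 : ℝ) ^ 2) * ∑ x : Blade n, (‖a x‖ * ‖b (x + z)‖) ^ 2 := h2
    _ = (2 : ℝ) ^ n * ∑ x : Blade n, ‖a x‖ ^ 2 * ‖b (x + z)‖ ^ 2 := by
        rw [hcard]
        congr 1
        exact Finset.sum_congr rfl fun x _ => by ring

/-- Summing the uniform envelope: `Σ_z |c_z|² ≤ N ‖a‖² ‖b‖²`. -/
theorem sum_norm_sq_twConv_le (p : ℕ) (a b : MV n ℂ) :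
    ∑ z : Blade n, ‖twConv (sigWeight ℂ p) a b z‖ ^ 2 ≤
      (2 : ℝ) ^ n * ((∑ x : Blade n, ‖a x‖ ^ 2) * (∑ y : Blade n, ‖b y‖ ^ 2)) := by
  calc ∑ z : Blade n, ‖twConv (sigWeight ℂ p) a b z‖ ^ 2
        ≤ ∑ _z : Blade n, (∑ x : Blade n, ‖a x‖ ^ 2) * (∑ y : Blade n, ‖b y‖ ^ 2) :=
          Finset.sum_le_sum fun z _ => norm_sq_twConv_le p a b z
    _ = _ := by simp

/-- **`p₀ ≤ 1`.** For normalised inputs the success probability `p₀ = 2^{-n} Σ_z |c_z|²` of the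
trivial-character branch is at most `1` — the elementary consistency check of
`CliffordTwistedConvolution.successProbability`, here obtained from the envelope alone. -/
theorem successProbability_le_one (p : ℕ) (a b : MV n ℂ)
    (ha : ∑ x : Blade n, ‖a x‖ ^ 2 = 1) (hb : ∑ y : Blade n, ‖b y‖ ^ 2 = 1) :
    ((2 : ℝ) ^ n)⁻¹ * ∑ z : Blade n, ‖twConv (sigWeight ℂ p) a b z‖ ^ 2 ≤ 1 := by
  have h := sum_norm_sq_twConv_le p a b
  rw [ha, hb, mul_one, mul_one] at h
  have hN : (0 : ℝ) < (2 : ℝ) ^ n := by positivity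
  rw [inv_mul_le_iff₀ hN, mul_one]
  exact h

/-- The product proposal is a probability distribution up to the factor `‖a‖²‖b‖²`:
`Σ_z Σ_x |a_x|² |b_{x⊕z}|² = (Σ_x |a_x|²)(Σ_y |b_y|²)`. -/
theorem sum_prodProposal (a b : MV n ℂ) :
    ∑ z : Blade n, ∑ x : Blade n, ‖a x‖ ^ 2 * ‖b (x + z)‖ ^ 2 =
      (∑ x : Blade n, ‖a x‖ ^ 2) * (∑ y : Blade n, ‖b y‖ ^ 2) := by
  rw [Finset.sum_comm, Finset.sum_mul]
  refine Finset.sum_congr rfl fun x _ => ?_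
  rw [← Finset.mul_sum, sum_comp_add_left (fun y => ‖b y‖ ^ 2) x]

/-- **Uniform proposal: acceptance probability = `p₀`.** Proposing `z` uniformly on the `N = 2ⁿ`
blades and accepting with probability `|c_z|²` (valid for normalised inputs by `norm_sq_twConv_le`)
accepts with overall probability `Σ_z N⁻¹ |c_z|² = 2^{-n} Σ_z |c_z|² = p₀`, and conditionally on
acceptance returns `z` with probability `|c_z|²/‖c‖²` (the post-selected quantum output law). -/
theorem uniformProposal_acceptance (p : ℕ) (a b : MV n ℂ)
    (ha : ∑ x : Blade n, ‖a x‖ ^ 2 = 1) (hb : ∑ y : Blade n, ‖b y‖ ^ 2 = 1) :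
    (∀ z : Blade n, ‖twConv (sigWeight ℂ p) a b z‖ ^ 2 ≤ 1) ∧
    ∑ z : Blade n, ((2 : ℝ) ^ n)⁻¹ * ‖twConv (sigWeight ℂ p) a b z‖ ^ 2 =
      ((2 : ℝ) ^ n)⁻¹ * ∑ z : Blade n, ‖twConv (sigWeight ℂ p) a b z‖ ^ 2 := by
  refine ⟨fun z => ?_, by rw [Finset.mul_sum]⟩
  have h := norm_sq_twConv_le p a b z
  rwa [ha, hb, mul_one] at h

/-- **Product proposal: acceptance probability = `p₀`.** With proposal mass
`π(z) = Σ_x |a_x|²|b_{x⊕z}|²` (normalised inputs, `sum_prodProposal`) and acceptance ratio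
`r(z) = |c_z|²/(N π(z))` (in `[0,1]` by `norm_sq_twConv_le_card_mul`; blades with `π(z) = 0` have
`c_z = 0` and are never proposed), the overall acceptance probability is
`Σ_z π(z) r(z) = 2^{-n} Σ_z |c_z|² = p₀`. -/
theorem prodProposal_acceptance (p : ℕ) (a b : MV n ℂ) :
    (∀ z : Blade n, ‖twConv (sigWeight ℂ p) a b z‖ ^ 2 /
        ((2 : ℝ) ^ n * ∑ x : Blade n, ‖a x‖ ^ 2 * ‖b (x + z)‖ ^ 2) ≤ 1) ∧
    ∑ z : Blade n, (∑ x : Blade n, ‖a x‖ ^ 2 * ‖b (x + z)‖ ^ 2) *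
        (‖twConv (sigWeight ℂ p) a b z‖ ^ 2 /
          ((2 : ℝ) ^ n * ∑ x : Blade n, ‖a x‖ ^ 2 * ‖b (x + z)‖ ^ 2)) =
      ((2 : ℝ) ^ n)⁻¹ * ∑ z : Blade n, ‖twConv (sigWeight ℂ p) a b z‖ ^ 2 := by
  have hN : (0 : ℝ) < (2 : ℝ) ^ n := by positivity
  constructor
  · intro z
    have h := norm_sq_twConv_le_card_mul p a b z
    by_cases hS : ∑ x : Blade n, ‖a x‖ ^ 2 * ‖b (x + z)‖ ^ 2 = 0
    · rw [hS, mul_zero, div_zero]; exact zero_le_one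
    · have hSpos : 0 < ∑ x : Blade n, ‖a x‖ ^ 2 * ‖b (x + z)‖ ^ 2 :=
        lt_of_le_of_ne (Finset.sum_nonneg fun x _ => by positivity) (Ne.symm hS)
      exact (div_le_one (by positivity)).mpr h
  · rw [Finset.mul_sum]
    refine Finset.sum_congr rfl fun z _ => ?_
    by_cases hS : ∑ x : Blade n, ‖a x‖ ^ 2 * ‖b (x + z)‖ ^ 2 = 0
    · have h := norm_sq_twConv_le_card_mul p a b z
      rw [hS, mul_zero] at h
      have h0 : ‖twConv (sigWeight ℂ p) a b z‖ ^ 2 = 0 := le_antisymm h (sq_nonneg _)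
      rw [hS, h0, zero_mul, mul_zero]
    · field_simp

end Summit.QuantumAdvantage.Dequantization.CliffordProductEnvelope
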